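/-
Copyright (c) 2026 the pub-hodgecm-mathlib formalisation cell (harness21).  Prover seat hodgecm-mathlib-K2E4-p11 (g5), Track B ∕ K2-LIT, h413 =
`stmt-HodgeConjecture-24833`, line `K2_E1_TraceFormulaBeta`, campaign «EIS-RANK-ONE» ∕ R8-LADDER-2, «MS-2» — THE OPERATOR ROAD, PART (O2a) (dealer K2E1-plan (g6) ruling (66)
«then (O2) `K_T` bounded `HX_k →L L²` via ★ hK1»): the high-cusp smoothing operator `K_Z : 𝓗_k(𝔛) →L L²(Z_T, μZ)`, RANK-GENERIC.
-/
import Summits.HodgeConjecture.HodgeConjecture.Theorems.K2E1BLHomogeneousL2U2        -- ★ p858…: brings ★ `sub_cnstN_mem_HNcusp`, `ae_weightedTruncMeasure_iff`, `ae_lt_borelQuotHeight_weightedTruncMeasure`, the `ι`∕`δ(h)`∕`cnstN` operator defs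
import HarnessLib

/-!
# h413 ∕ Track B «K2-LIT», «MS-2» — `K2E1BLHighCuspOperatorU` (RANK `N`): THE HIGH-CUSP SMOOTHING OPERATOR `K_Z : 𝓗_k(𝔛) →L[ℂ] L²(Z_T, μZ) = 𝓗_0(Z_T)`,
# `K_Z u = R(h)(ιu − cnstN ιu)` a.e. on `Z_T`, from K2's cusp-decay letter `hK1`

Cell `pub/hodgecm-mathlib`, crux H413 = `stmt-HodgeConjecture-24833`, route `HCCMUnconditional`; dealer K2E1-plan (g6) ruling (66) (operator road (O), part (O2)).  THEOREMS ONLY;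
lane `--kind proof --supports stmt-HodgeConjecture-24833 --as helper` (count-neutral; closes no socket).
THE MATHEMATICS [BernsteinLapid2019, §4 Claims 4–5 p. 10; MoeglinWaldspurger1995, I.2.13].  For `u ∈ 𝓗_k(𝔛)` put `f_u := ι u − cnstN(ι u) ∈ 𝓗_k(Z_a)^cusp` (★ `sub_cnstN_mem_HNcusp`)
and `g_u := δ(h) f_u ∈ 𝓗_k(Z_{a₀})`, a.e. the right convolution `R(h) f_u` (★ `deltaShift_spec`).  K2's cusp-decay letter `hK1` — `‖R(h)f(z)‖ ≤ C‖f‖·HZ(z)^{−m}` a.e. on `Z_{a₀}` for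
cuspidal `f` — makes `g_u` ESSENTIALLY BOUNDED by `C‖f_u‖·T^{−m}` on `Z_T` (`T ≥ a₀`, `T > 0`, `m ≥ 0`; `HZ > T` a.e. there), hence square-integrable for the FINITE measure `μZ|_{Z_T}`
(= ★ `weightedTruncMeasure 0 T μZ`, the weight `HZ^0 = 1`): `u ↦ [g_u] ∈ L²(Z_T, μZ)` is linear (the operators `ι`, `cnstN`, `δ(h)` are) and bounded by
`μZ(Z_T)^{1/2}·C·T^{−m}·‖(1 − cnstN)∘ι‖·‖u‖` — a continuous linear map `K_Z : 𝓗_k(𝔛) →L[ℂ] 𝓗_0(Z_T)` with `K_Z u =ᵐ R(h)(ιu − cnstN ιu)` on `Z_T`.  The target `𝓗_0(Z_T)` is chosen so that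
the unfolding ★ `exists_forall_mul_lintegral_comp_pZX_eq` (at `k := 0`, `c₀ := T`) transports it to `L²(𝔛_T, μ)` verbatim ((O2b)).
* `ae_weightedTruncMeasure_zero_of_ae` — a.e. for `wtm_{k,a₀}` gives a.e. for `wtm_{0,T}` when `a₀ ≤ T`.
* **`exists_highCuspOperator`** — the head.
HONEST LABEL.  Count-neutral helper; proves no printed statement; `hK1`, `IotaBound`, `ShiftBound` are LETTERS (★ K2 `hK1_cm_two_of`, ★ P3 discharge them at the CM pair); HC_CM is proved
only modulo the 7 printed citations (2 remaining named inputs: hLiu418 = `stmt-HodgeConjecture-24832`, h413 = `stmt-HodgeConjecture-24833`) until rung 0 closes.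

## References
* [BernsteinLapid2019] J. Bernstein, E. Lapid, *On the meromorphic continuation of Eisenstein series*, J. AMS 37 (2024), §4 Claims 4–5 (p. 10).
* [MoeglinWaldspurger1995] C. Mœglin, J.-L. Waldspurger, *Spectral decomposition and Eisenstein series* (1995), I.2.13.
-/

set_option autoImplicit false
set_option linter.dupNamespace false  -- the mandated namespace repeats the summit's segment (`HodgeConjecture.HodgeConjecture`)

noncomputable section

open MeasureTheory Measure NumberField IsDedekindDomain Set Filter Topology
open scoped ENNReal NNReal
open Literature.NumberTheory.Automorphic Literature.NumberTheory.Automorphic.UnitaryGroup AdelicGroupData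
open Summit.HodgeConjecture.HodgeConjecture.Cruxes.H413.K2E1BLBorelSpacesU2Defs
open Summit.HodgeConjecture.HodgeConjecture.Cruxes.H413.K2E1BLBorelOperatorsU2Defs
open Summit.HodgeConjecture.HodgeConjecture.Cruxes.H413.K2E1BLSpacesU2 (sub_cnstN_mem_HNcusp)
open Summit.HodgeConjecture.HodgeConjecture.Cruxes.H413.K2E1BLShiftBoundU2 (ae_weightedTruncMeasure_iff)
open Summit.HodgeConjecture.HodgeConjecture.Cruxes.H413.K2E1TruncatedCuspCompactU2 (ae_lt_borelQuotHeight_weightedTruncMeasure measurableSet_lt_borelQuotHeight)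

namespace Summit.HodgeConjecture.HodgeConjecture.Cruxes.H413.K2E1BLHighCuspOperatorU

variable {F E : Type} [Field F] [NumberField F] [Field E] [NumberField E] [Algebra F E] {c : E ≃ₐ[F] E} {N : ℕ} [NeZero N]

/-- **a.e. on `Z_{a₀}` for `HZ^{−2k}μZ|_{Z_{a₀}}` gives a.e. on `Z_T` for `μZ|_{Z_T} = wtm_{0,T}`** when `a₀ ≤ T` (★ `ae_weightedTruncMeasure_iff` twice; `Z_T ⊆ Z_{a₀}`).
[cite: BernsteinLapid2019, §4 p. 10] -/
theorem ae_weightedTruncMeasure_zero_of_ae {μZ : Measure (borelQuotient F E c N)} {k : ℕ} {a₀ T : ℝ≥0} (haT : a₀ ≤ T) {p : borelQuotient F E c N → Prop}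
    (h : ∀ᵐ z ∂(weightedTruncMeasure F E c N k a₀ μZ), p z) : ∀ᵐ z ∂(weightedTruncMeasure F E c N 0 T μZ), p z := by
  rw [ae_weightedTruncMeasure_iff] at h ⊢
  exact ae_restrict_of_ae_restrict_of_subset (fun z (hz : T < borelQuotHeight F E c N z) => lt_of_le_of_lt haT hz) h

variable [MeasurableSpace (quasiSplit F E c N).Adelic]

/-- **(O2a) THE HIGH-CUSP SMOOTHING OPERATOR `K_Z : 𝓗_k(𝔛) →L[ℂ] 𝓗_0(Z_T) = L²(Z_T, μZ)`.**  Letters: `hb : IotaBound k a` (the pull-back `ι : 𝓗_k(𝔛) →L 𝓗_k(Z_a)`), `hs : ShiftBound k a a₀ h`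
(the smoothing `δ(h) : 𝓗_k(Z_a) →L 𝓗_k(Z_{a₀})`), K2's cusp decay `hK1` on `Z_{a₀}` with `C, m ≥ 0`, levels `a₀ ≤ T`, `0 < T`, and `μZ(Z_T) < ∞` (as the instance
`IsFiniteMeasure (wtm_{0,T} μZ)`).  THEN there is a continuous linear `K_Z : 𝓗_k(𝔛) →L[ℂ] 𝓗_0(Z_T)` with `K_Z u =ᵐ[wtm_{0,T}] R(h)(ι u − cnstN(ι u))` for every `u`, and the bound
`‖K_Z u‖ ≤ (wtm_{0,T} Z)^{1/2}·(C·‖ι u − cnstN(ι u)‖·T^{−m})`. [cite: BernsteinLapid2019, §4 Claims 4–5 (p. 10)] [cite: MoeglinWaldspurger1995, I.2.13] -/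
theorem exists_highCuspOperator {k : ℕ} {a a₀ T : ℝ≥0} {μ : Measure (quasiSplit F E c N).automorphicQuotient} {μZ : Measure (borelQuotient F E c N)}
    {νG : Measure (quasiSplit F E c N).Adelic} {h : (quasiSplit F E c N).Adelic → ℂ}
    (hb : IotaBound F E c N k a μ μZ) (hs : ShiftBound F E c N k a a₀ νG μZ h) {C m : ℝ} (hC : 0 ≤ C) (hm : 0 ≤ m)
    (hK1 : ∀ f : HNcusp F E c N k a μZ, ∀ᵐ z ∂(weightedTruncMeasure F E c N k a₀ μZ),
      ‖rightConvFun F E c N νG h ((f : HN F E c N k a μZ) : borelQuotient F E c N → ℂ) z‖ ≤ C * ‖f‖ * ((borelQuotHeight F E c N z : ℝ)) ^ (-m))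
    (haT : a₀ ≤ T) (hT : 0 < T) [IsFiniteMeasure (weightedTruncMeasure F E c N 0 T μZ)] :
    ∃ KZ : HX F E c N k μ →L[ℂ] HN F E c N 0 T μZ,
      (∀ u : HX F E c N k μ, ((KZ u : HN F E c N 0 T μZ) : borelQuotient F E c N → ℂ) =ᵐ[weightedTruncMeasure F E c N 0 T μZ]
        rightConvFun F E c N νG h ((iota hb u - cnstN F E c N k a μZ (iota hb u) : HN F E c N k a μZ) : borelQuotient F E c N → ℂ)) ∧
      ∀ u : HX F E c N k μ, ‖KZ u‖ ≤ ((weightedTruncMeasure F E c N 0 T μZ) Set.univ).toReal ^ (1 / 2 : ℝ) *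
        (C * ‖iota hb u - cnstN F E c N k a μZ (iota hb u)‖ * (T : ℝ) ^ (-m)) := by
  -- the operators: `Φ u = ι u − cnstN(ι u)`, `G u = δ(h)(Φ u)`
  set Φ : HX F E c N k μ →L[ℂ] HN F E c N k a μZ := ((1 : HN F E c N k a μZ →L[ℂ] HN F E c N k a μZ) - cnstN F E c N k a μZ).comp (iota hb) with hΦdef
  have hΦ : ∀ u : HX F E c N k μ, Φ u = iota hb u - cnstN F E c N k a μZ (iota hb u) := fun u => rfl
  set G : HX F E c N k μ →L[ℂ] HN F E c N k a₀ μZ := (deltaShift hs).comp Φ with hGdef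
  have hG : ∀ u : HX F E c N k μ, G u = deltaShift hs (Φ u) := fun u => rfl
  -- the essential bound on `Z_T`
  have hbd : ∀ u : HX F E c N k μ, ∀ᵐ z ∂(weightedTruncMeasure F E c N 0 T μZ),
      ‖((G u : HN F E c N k a₀ μZ) : borelQuotient F E c N → ℂ) z‖ ≤ C * ‖Φ u‖ * (T : ℝ) ^ (-m) := by
    intro u
    have h1 := hK1 ⟨Φ u, by rw [hΦ]; exact sub_cnstN_mem_HNcusp (iota hb u)⟩
    have h2 := deltaShift_spec hs (Φ u)
    filter_upwards [ae_weightedTruncMeasure_zero_of_ae haT h1, ae_weightedTruncMeasure_zero_of_ae haT h2, ae_lt_borelQuotHeight_weightedTruncMeasure 0 T μZ] with z hz1 hz2 hzT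
    rw [hG, hz2]
    refine hz1.trans (mul_le_mul_of_nonneg_left ?_ (mul_nonneg hC (norm_nonneg _)))
    exact Real.rpow_le_rpow_of_nonpos (NNReal.coe_pos.2 hT) (NNReal.coe_le_coe.2 hzT.le) (neg_nonpos.2 hm)
  -- square-integrability on the finite measure space `(Z_T, μZ)`
  have hmem : ∀ u : HX F E c N k μ, MemLp (((G u : HN F E c N k a₀ μZ) : borelQuotient F E c N → ℂ)) 2 (weightedTruncMeasure F E c N 0 T μZ) := fun u =>
    MemLp.of_bound (Lp.stronglyMeasurable (G u)).aestronglyMeasurable _ (hbd u)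
  -- the linear map `u ↦ [g_u]`
  let Klin : HX F E c N k μ →ₗ[ℂ] HN F E c N 0 T μZ :=
    { toFun := fun u => (hmem u).toLp _
      map_add' := fun u u' => by
        rw [← MemLp.toLp_add (hmem u) (hmem u')]
        refine MemLp.toLp_congr _ _ ?_
        have h1 : ((G (u + u') : HN F E c N k a₀ μZ) : borelQuotient F E c N → ℂ) =ᵐ[weightedTruncMeasure F E c N k a₀ μZ]
            ((G u : HN F E c N k a₀ μZ) : borelQuotient F E c N → ℂ) + ((G u' : HN F E c N k a₀ μZ) : borelQuotient F E c N → ℂ) := by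
          rw [map_add]; exact Lp.coeFn_add _ _
        exact ae_weightedTruncMeasure_zero_of_ae haT h1
      map_smul' := fun r u => by
        rw [RingHom.id_apply, ← MemLp.toLp_const_smul r (hmem u)]
        refine MemLp.toLp_congr _ _ ?_
        have h1 : ((G (r • u) : HN F E c N k a₀ μZ) : borelQuotient F E c N → ℂ) =ᵐ[weightedTruncMeasure F E c N k a₀ μZ]
            r • ((G u : HN F E c N k a₀ μZ) : borelQuotient F E c N → ℂ) := by
          rw [map_smul]; exact Lp.coeFn_smul _ _
        exact ae_weightedTruncMeasure_zero_of_ae haT h1 }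
  -- its bound
  have hnorm : ∀ u : HX F E c N k μ, ‖Klin u‖ ≤ ((weightedTruncMeasure F E c N 0 T μZ) Set.univ).toReal ^ (1 / 2 : ℝ) * (C * ‖Φ u‖ * (T : ℝ) ^ (-m)) := by
    intro u
    have hB : 0 ≤ C * ‖Φ u‖ * (T : ℝ) ^ (-m) := mul_nonneg (mul_nonneg hC (norm_nonneg _)) (Real.rpow_nonneg (NNReal.coe_nonneg T) _)
    change ‖(hmem u).toLp _‖ ≤ _
    rw [Lp.norm_toLp]
    have h1 := eLpNorm_le_of_ae_bound (p := (2 : ℝ≥0∞)) (hbd u)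
    have hne : (weightedTruncMeasure F E c N 0 T μZ) Set.univ ^ (2 : ℝ≥0∞).toReal⁻¹ * ENNReal.ofReal (C * ‖Φ u‖ * (T : ℝ) ^ (-m)) ≠ ∞ :=
      ENNReal.mul_ne_top (ENNReal.rpow_ne_top_of_nonneg (by norm_num) (measure_ne_top _ _)) ENNReal.ofReal_ne_top
    refine (ENNReal.toReal_mono hne h1).trans_eq ?_
    rw [ENNReal.toReal_mul, ENNReal.toReal_ofReal hB, ← ENNReal.toReal_rpow, ENNReal.toReal_ofNat]
    norm_num
  have hbound : ∃ B : ℝ, ∀ u : HX F E c N k μ, ‖Klin u‖ ≤ B * ‖u‖ := by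
    refine ⟨((weightedTruncMeasure F E c N 0 T μZ) Set.univ).toReal ^ (1 / 2 : ℝ) * (C * ‖Φ‖ * (T : ℝ) ^ (-m)), fun u => (hnorm u).trans ?_⟩
    have h1 : ‖Φ u‖ ≤ ‖Φ‖ * ‖u‖ := Φ.le_opNorm u
    have h2 : 0 ≤ ((weightedTruncMeasure F E c N 0 T μZ) Set.univ).toReal ^ (1 / 2 : ℝ) := Real.rpow_nonneg ENNReal.toReal_nonneg _
    have h3 : 0 ≤ (T : ℝ) ^ (-m) := Real.rpow_nonneg (NNReal.coe_nonneg T) _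
    calc ((weightedTruncMeasure F E c N 0 T μZ) Set.univ).toReal ^ (1 / 2 : ℝ) * (C * ‖Φ u‖ * (T : ℝ) ^ (-m))
        ≤ ((weightedTruncMeasure F E c N 0 T μZ) Set.univ).toReal ^ (1 / 2 : ℝ) * (C * (‖Φ‖ * ‖u‖) * (T : ℝ) ^ (-m)) :=
          mul_le_mul_of_nonneg_left (mul_le_mul_of_nonneg_right (mul_le_mul_of_nonneg_left h1 hC) h3) h2
      _ = ((weightedTruncMeasure F E c N 0 T μZ) Set.univ).toReal ^ (1 / 2 : ℝ) * (C * ‖Φ‖ * (T : ℝ) ^ (-m)) * ‖u‖ := by ring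
  refine ⟨Klin.mkContinuousOfExistsBound hbound, fun u => ?_, fun u => ?_⟩
  · rw [LinearMap.mkContinuousOfExistsBound_apply]
    refine (MemLp.coeFn_toLp (hmem u)).trans ?_
    rw [hG, hΦ]
    exact ae_weightedTruncMeasure_zero_of_ae haT (deltaShift_spec hs _)
  · rw [LinearMap.mkContinuousOfExistsBound_apply]
    exact (hnorm u).trans_eq (by rw [hΦ])

end Summit.HodgeConjecture.HodgeConjecture.Cruxes.H413.K2E1BLHighCuspOperatorU

end
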